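import Summits.QuantumFields.YangMills.Theorems.FluctuationComparisonRegPrIntLS2BetaRhoPColumnRead
import HarnessLib

/-!
# S2β · W-ρκ (k1) «THE ρP COLUMN», FILE 2 of 2 — THE BUDGET: ✓∕⧗`hρκ_of_columns`'s `hP` binder (`Σ_{t<K−J} L^t·Σ_B ρP(t,B)² ≤ C_P·e^{cΣθ}·purse + β_P·S′`, station
# texts VERBATIM) at FILE 1's `ρP` (the c₁ read-sup at thickness `2L+1`), from ✓p836340 `curlBudget_of_chartTower` (`θr := 2L+1`, `Cst := 1`) and ONE purse-shaped
# source-energy letter — with `C_P := 2κ²νC_b·(4∕L + W·Csrc)`, `β_P := 2κ²νC_b·W·βsrc` EXPLICIT (RULING «FB-σ»: the ρP column's constants in closed form)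

Cell `ym3-torus` (YM ladder rung R3 = continuum `SU(2)` Yang–Mills on the three-torus at fixed lattice data — a RUNG: NOT d = 4, NOT infinite volume, NOT a mass gap,
NOT Clay).  Width seat «width 10» `ym3-torus-px10` (gen 26); crux `stmt-QuantumFields-20520`, LINE g18-1 S2β; ARCHITECT RULING «ρκ-CURL» debt (k1).
`--kind proof --supports stmt-QuantumFields-20520 --as helper`, count-neutral, DEFINITION-FREE (0 `def`, 0 `instance`, 0 `notation`, 0 `sorry`, default heartbeats).

WHAT IS PROVED (sorry-free).  ★`budget_shape` (real algebra); ★★★**`hP_of_chartTower`** — at FIXED data, from ✓`curlBudget_of_chartTower`'s letters ((T) tower-in-chart at window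
`1∕4`, M-1‴'s classes `α δ αp` (+ signs), corner sizes `M`, FREE remainder `R`, all VERBATIM for the quaternionic chart tower `X` given by `hXdef`) and the source ENERGY letter
**(SRC-P)** `Σ_{i<K−J} w(i+1)·L^{K−J−1−(i+1)}·Σ_μΣ_νΣ_{y′}(𝟙[μ<ν]·(src_{M-1‴} + rem + 𝟙[i=0]·|Idx|⁻¹Σ_a rem₀))² ≤ Csrc·e^{c·Σθ}·purse + βsrc·S′` (`c, θ ≥ 0`):
**`Σ_{t<K−J} L^t·Σ_B ρP(t,B)² ≤ (2·κ²νC_b·(4·L⁻¹ + W·Csrc))·e^{c·Σθ}·purse + (2·κ²νC_b·W·βsrc)·S′`**, `κ²νC_b = (5^d)²·((2((2L+1)+2)+1)^d·6)·(2(L³−1)∕(L³−3))` —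
i.e. the `hP` binder of `hρκ_of_columns` at `C_P := 2κ²νC_b(4∕L + W·Csrc)`, `β_P := 2κ²νC_b·W·βsrc` (reindex `K − (J+(t+1)) = K − J − 1 − t`, `L^{K−J}·REL ≤ purse ≤ e^{cΣθ}·purse`).

HONEST SCOPE.  Re-plumbing of ✓p836340 into the κ-ratio column's currency; nothing of Bałaban's renormalisation-group analysis is asserted or proved ([Balaban1985Averaging] Prop. 4
(128)–(135) pp.37–38; [Balaban1987RG1] (0.1)–(0.4), (0.11) pp.251–253); (T), the classes, sizes, `R`, (SRC-P), the other columns (ρ̃, m), every budget, (ST⁗)∕LOC⁗, h3 are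
HYPOTHESES or others'; GAP♯∘ (`stub_uniformFibreGapOrbit`, registry 3732b7df UNTOUCHED, 0∕5), S2β, the five registered stubs, crux 20520, 19936, 19200 and `YM3TorusSU2` are NOT
proved; no registered stub is closed; rung R3 — NOT d = 4, NOT infinite volume, NOT a mass gap, NOT Clay; the Yang–Mills mass gap is NOT proved.
-/

set_option autoImplicit false

noncomputable section

open scoped Matrix.Norms.L2Operator
open Finset

namespace Summit.QuantumFields.YangMills.Theorems.FluctuationComparisonRegPrIntLS2BetaRhoPColumnBudget

open Literature.MathematicalPhysics.QuantumFieldTheory.Balaban1983to89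
open Literature.MathematicalPhysics.QuantumFieldTheory.Balaban1983to89.T4Continuum
open Literature.MathematicalPhysics.QuantumFieldTheory.Balaban1983to89.T3ContinuumYM3Torus
open Literature.MathematicalPhysics.QuantumFieldTheory.Balaban1983to89.T3LevelShift
open Literature.MathematicalPhysics.QuantumFieldTheory.Balaban1983to89.T3TiltDescent
open Literature.MathematicalPhysics.QuantumFieldTheory.Balaban1983to89.T3UnitLawDensityEML (ℰp)
open Literature.MathematicalPhysics.QuantumFieldTheory.Balaban1983to89.T4HaarSU2ExpChart (expPoint)
open Literature.MathematicalPhysics.QuantumFieldTheory.Balaban1983to89.T4ExpWindowSmallField (logVec)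
open Literature.MathematicalPhysics.QuantumFieldTheory.Balaban1983to89.HaarExponentialChart
open Literature.MathematicalPhysics.QuantumFieldTheory.Balaban1983to89.HaarExponentialChart.IsChartRep
open Literature.MathematicalPhysics.QuantumFieldTheory.Balaban1983to89.BlockAveraging (Idx blockAvg avgFun loopHol)
open Literature.MathematicalPhysics.QuantumFieldTheory.Balaban1983to89.ExpMeanLog (expMeanLogSU deltaSU)
open Literature.MathematicalPhysics.QuantumFieldTheory.Balaban1983to89.BlockAveragingEMLLinearisedBackground (covWalkSum)
open Literature.MathematicalPhysics.QuantumFieldTheory.Balaban1983to89.B10Eq47AxialChi (shiftN)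
open Literature.MathematicalPhysics.QuantumFieldTheory.Balaban1983to89.B14.Eq22Determines (blockIter)
open Literature.MathematicalPhysics.QuantumFieldTheory.Balaban1983to89.B10Eq27TorusAxialLog (rel)
open Literature.MathematicalPhysics.QuantumFieldTheory.Balaban1983to89.B10Eq18SigmaSU2 (su2Coord)
open Literature.MathematicalPhysics.QuantumFieldTheory.Balaban1983to89.B10Eq18SigmaSU2Haar (rev)
open Literature.MathematicalPhysics.QuantumLattice (su2Quat)
open Summit.QuantumFields.YangMills.Theorems.FluctuationComparisonRegPrIntLS2BetaChartReadDescentOntoExpPoint (su2Coord_rev_mem_lie)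
open Summit.QuantumFields.YangMills.Theorems.FluctuationComparisonRegPrIntLS2BetaCurlBudgetEngine (kernelConst_nonneg)
open Summit.QuantumFields.YangMills.Theorems.FluctuationComparisonRegPrIntLS2BetaCurlBudgetOfChartTower (curlBudget_of_chartTower)
open Summit.QuantumFields.YangMills.Theorems.FluctuationComparisonRegPrIntLS2BetaRelPlaqCurlJunction (sum_dist1_relPlaq_sq_le_four_mul)

variable (F : T3Family)

/-- ★ The budget re-shaping: `a·(l·X + W·(C·E·P + β·S)) ≤ (a·(l + W·C))·E·P + (a·W·β)·S` for `0 ≤ a, l`, `0 ≤ X ≤ P`, `1 ≤ E`. [folklore] -/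
theorem budget_shape {a l X P E W C β S : ℝ} (ha : 0 ≤ a) (hl : 0 ≤ l) (hX0 : 0 ≤ X) (hXP : X ≤ P) (hE : 1 ≤ E) :
    a * (l * X + W * (C * E * P + β * S)) ≤ a * (l + W * C) * E * P + a * W * β * S := by
  have hP : 0 ≤ P := hX0.trans hXP
  have h1 : X ≤ E * P := hXP.trans (le_mul_of_one_le_left hP hE)
  have h2 : a * l * X ≤ a * l * (E * P) := mul_le_mul_of_nonneg_left h1 (mul_nonneg ha hl)
  nlinarith [h2]

/-- ★★★ **THE `hP` BUDGET OF THE ρP COLUMN** — see the module header. [cite: Balaban1985Averaging, (19)-(20) p.21, Prop. 4 (128)-(135) pp.37-38; Balaban1987RG1, (0.1)-(0.4), (0.11) pp.251-253] -/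
theorem hP_of_chartTower {J K : ℕ} (hJK : J ≤ K)
    (U₀ : GaugeField (F.P K) 0 (Matrix.specialUnitaryGroup (Fin 2) ℂ)) (ζ : PBond (F.P K) 0 → EuclideanSpace ℝ (Fin 3)) (θ : ℕ → ℝ) (hθ : ∀ i, 0 ≤ θ i) (c : ℝ) (hc : 0 ≤ c)
    (w : ℕ → ℝ) (hw : ∀ j, 0 < w j) (W : ℝ) (hW : ∀ n, ∑ j ∈ Finset.Icc 1 n, (w j)⁻¹ ≤ W)
    (X : (i : ℕ) → PBond (F.P K) i → (specialUnitaryLogChart (Fin 2)).lie)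
    (hXdef : X = fun (i : ℕ) (b : PBond (F.P K) i) =>
      (⟨su2Coord (rev (logVec (su2Quat (Averaging.iter (fun k => BlockAveraging.blockAvg (P := F.P K) (j := k) ℰp) i (fun ℓ => expPoint (ζ ℓ) * U₀ ℓ : GaugeField (F.P K) 0 (Matrix.specialUnitaryGroup (Fin 2) ℂ)) b * (Averaging.iter (fun k => BlockAveraging.blockAvg (P := F.P K) (j := k) ℰp) i U₀ b)⁻¹)))), su2Coord_rev_mem_lie _⟩ : (specialUnitaryLogChart (Fin 2)).lie))
    (Mg : ℕ → ℝ) (hMg : ∀ t, t ≤ K - J → ∀ b : PBond (F.P K) t,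
      ‖logVec (su2Quat (Averaging.iter (fun k => BlockAveraging.blockAvg (P := F.P K) (j := k) ℰp) t (fun ℓ => expPoint (ζ ℓ) * U₀ ℓ : GaugeField (F.P K) 0 (Matrix.specialUnitaryGroup (Fin 2) ℂ)) b * (Averaging.iter (fun k => BlockAveraging.blockAvg (P := F.P K) (j := k) ℰp) t U₀ b)⁻¹))‖ ≤ Mg t)
    (hMg4 : ∀ t, t ≤ K - J → Mg t ≤ 1 / 4)
    (α δ : ℕ → ℝ) (αp : Fin (F.P K).d → Fin (F.P K).d → ℕ → ℝ)
    (hα : ∀ i, i < K - J → ∀ (c : PBond (F.P K) (i + 1)) (ι : Idx (F.P K)), dist1 (loopHol (Averaging.iter (fun k => BlockAveraging.blockAvg (P := F.P K) (j := k) ℰp) i U₀) c ι) ≤ α (i + 1))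
    (hα24 : ∀ i, i < K - J → α (i + 1) ≤ 1 / 24) (hαδ : ∀ i, i < K - J → α (i + 1) < deltaSU (Fin 2))
    (hα0 : ∀ i, 0 ≤ α i) (hδ : ∀ i, i < K - J → 0 ≤ δ (i + 1)) (hUs : ∀ i, i < K - J → PlaqSmall (δ (i + 1)) (Averaging.iter (fun k => BlockAveraging.blockAvg (P := F.P K) (j := k) ℰp) i U₀))
    (hαp0 : ∀ μ ν i, 0 ≤ αp μ ν i)
    (hαp : ∀ μ ν : Fin (F.P K).d, μ < ν → ∀ i, i < K - J → ∀ y' : Site (F.P K) (i + 1),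
      dist1 (holAt (avgFun (expMeanLogSU (n := Fin 2)) (Averaging.iter (fun k => BlockAveraging.blockAvg (P := F.P K) (j := k) ℰp) i U₀)) (walk y' [((μ, true) : Letter (F.P K).d), (ν, true), (μ, false), (ν, false)])) ≤ αp μ ν (i + 1))
    (M : Fin (F.P K).d → Fin (F.P K).d → (i : ℕ) → Site (F.P K) i → ℝ) (hM : ∀ μ ν i x, 0 ≤ M μ ν i x)
    (hXM : ∀ μ ν : Fin (F.P K).d, μ < ν → ∀ i, i < K - J → ∀ (y' : Site (F.P K) (i + 1)) (b : PBond (F.P K) i),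
      (blockOf b.src = y' ∨ blockOf b.src = y'.shift μ ∨ blockOf b.src = y'.shift ν ∨ blockOf b.src = (y'.shift μ).shift ν) → ‖X i b‖ ≤ M μ ν (i + 1) y')
    (R : Fin (F.P K).d → Fin (F.P K).d → (i : ℕ) → Site (F.P K) i → ℝ) (hR0 : ∀ μ ν i x, 0 ≤ R μ ν i x)
    (hR : ∀ μ ν : Fin (F.P K).d, μ < ν → ∀ i, i < K - J → ∀ (y' : Site (F.P K) (i + 1)) (c : PBond (F.P K) (i + 1)),
      (c = ⟨y', μ⟩ ∨ c = ⟨y'.shift μ, ν⟩ ∨ c = ⟨y'.shift ν, μ⟩ ∨ c = ⟨y', ν⟩) →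
      ‖(((isChartRep_specialUnitaryGroup (n := Fin 2)).logChart (avgFun (expMeanLogSU (n := Fin 2)) (fun b => (isChartRep_specialUnitaryGroup (n := Fin 2)).expChart (X i b) * Averaging.iter (fun k => BlockAveraging.blockAvg (P := F.P K) (j := k) ℰp) i U₀ b) c * (avgFun (expMeanLogSU (n := Fin 2)) (Averaging.iter (fun k => BlockAveraging.blockAvg (P := F.P K) (j := k) ℰp) i U₀) c)⁻¹) : (specialUnitaryLogChart (Fin 2)).lie) : Matrix (Fin 2) (Fin 2) ℂ) -
        ((fderiv ℝ (fun (A : PBond (F.P K) i → (specialUnitaryLogChart (Fin 2)).lie) (c : PBond (F.P K) (i + 1)) => (isChartRep_specialUnitaryGroup (n := Fin 2)).logChart (avgFun (expMeanLogSU (n := Fin 2)) (fun b => (isChartRep_specialUnitaryGroup (n := Fin 2)).expChart (A b) * Averaging.iter (fun k => BlockAveraging.blockAvg (P := F.P K) (j := k) ℰp) i U₀ b) c * (avgFun (expMeanLogSU (n := Fin 2)) (Averaging.iter (fun k => BlockAveraging.blockAvg (P := F.P K) (j := k) ℰp) i U₀) c)⁻¹)) 0 (X i) c : (specialUnitaryLogChart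 (Fin 2)).lie) : Matrix (Fin 2) (Fin 2) ℂ)‖ ≤ R μ ν (i + 1) y')
    (Csrc βsrc : ℝ)
    (hSRC : ∑ i ∈ Finset.range (K - J), w (i + 1) * (F.L : ℝ) ^ (K - J - 1 - (i + 1)) *
        ∑ μ : Fin (F.P K).d, ∑ ν : Fin (F.P K).d, ∑ y' : Site (F.P K) (i + 1),
          (if μ < ν then
          (((F.P K).L : ℝ) * (((F.P K).L : ℝ) * (2 * δ (i + 1) * (((F.P K).L : ℝ) + 2 * (F.P K).L + 2) * M μ ν (i + 1) y')) + 48 * α (i + 1) * (((F.P K).L : ℝ) * M μ ν (i + 1) y') +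
            (2 * αp μ ν (i + 1) * (((((F.P K).d + 2) * (F.P K).L : ℕ) : ℝ) * M μ ν (i + 1) y') + 24 * α (i + 1) * (((((F.P K).d + 2) * (F.P K).L : ℕ) : ℝ) * M μ ν (i + 1) y')) +
            4 * (404 * ((((F.P K).d + 2) * (F.P K).L : ℕ) : ℝ) * α (i + 1) * M μ ν (i + 1) y') + 4 * R μ ν (i + 1) y' +
            2 * δ (i + 1) * (((F.P K).L : ℝ) ^ 2 * M μ ν (i + 1) y')) +
          (Real.exp (‖X (i + 1) ⟨y', μ⟩‖ + ‖X (i + 1) ⟨(y').shift μ, ν⟩‖ + ‖X (i + 1) ⟨(y').shift ν, μ⟩‖ + ‖X (i + 1) ⟨y', ν⟩‖) - 1 - (‖X (i + 1) ⟨y', μ⟩‖ + ‖X (i + 1) ⟨(y').shift μ, ν⟩‖ + ‖X (i + 1) ⟨(y').shift ν, μ⟩‖ + ‖X (i + 1) ⟨y', ν⟩‖)) +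
          (if i = 0 then ((Fintype.card (Idx (F.P K)) : ℝ)⁻¹ *
            ∑ a ∈ (Finset.univ : Finset (Idx (F.P K))) ×ˢ (Finset.range (F.P K).L ×ˢ Finset.range (F.P K).L),
              (Real.exp (‖X i ⟨(shiftN (shiftN (Site.blockSite y' a.1.1) μ a.2.1) ν a.2.2), μ⟩‖ + ‖X i ⟨((shiftN (shiftN (Site.blockSite y' a.1.1) μ a.2.1) ν a.2.2)).shift μ, ν⟩‖ + ‖X i ⟨((shiftN (shiftN (Site.blockSite y' a.1.1) μ a.2.1) ν a.2.2)).shift ν, μ⟩‖ + ‖X i ⟨(shiftN (shiftN (Site.blockSite y' a.1.1) μ a.2.1) ν a.2.2), ν⟩‖) - 1 - (‖X i ⟨(shiftN (shiftN (Site.blockSite y' a.1.1) μ a.2.1) ν a.2.2), μ⟩‖ + ‖X i ⟨((shiftN (shiftN (Site.blockSite y' a.1.1) μ a.2.1) ν a.2.2)).shift μ, ν⟩‖ + ‖X i ⟨((shiftN (shiftN (Site.blockSite y' a.1.1) μ a.2.1) ν a.2.2)).shift ν, μ⟩‖ + ‖X i ⟨(shiftN (shiftN (Site.blockSite y' a.1.1)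 μ a.2.1) ν a.2.2), ν⟩‖))) else 0)
          else 0) ^ 2 ≤ Csrc * Real.exp (c * ∑ i ∈ Finset.range (K - J), (((5 * F.L : ℕ) : ℝ) ^ 2 / 4) * θ (K - i)) * (((F.L : ℝ)⁻¹) ^ (K - J) * ∑ ℓ : PBond (F.P K) 0, ‖ζ ℓ‖ ^ 2 +
                (F.L : ℝ) ^ (K - J) * ∑ p : Plaq (F.P K) 0,
                  (1 - reTr ((GaugeField.plaqHol U₀ p)⁻¹ * GaugeField.plaqHol (fun ℓ => expPoint (ζ ℓ) * U₀ ℓ : GaugeField (F.P K) 0 (Matrix.specialUnitaryGroup (Fin 2) ℂ)) p))) + βsrc * (∑ t ∈ Finset.range (K - J), (if ht : t < K - J then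
          (F.L : ℝ) ^ t * ∑ B : PBond (F.P J) 0,
            ‖(fun ℓ' : PBond (F.P (J + (t + 1))) 0 =>
              if ∃ z : Site (F.P (J + (t + 1))) 0,
                (B14.Eq22Determines.blockIter (t + 1) z = (bondShift (F.sitesPerDir_eq (m := F.m) (K := J) (j := 0) (m' := F.m) (K' := J + (t + 1)) (j' := t + 1) (by omega)) B).src ∨ B14.Eq22Determines.blockIter (t + 1) z = (bondShift (F.sitesPerDir_eq (m := F.m) (K := J) (j := 0) (m' := F.m) (K' := J + (t + 1)) (j' := t + 1) (by omega)) B).tgt) ∧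
                ∀ ν, (B10Eq27TorusAxialLog.rel z ℓ'.src ν).natAbs ≤ 2
              then logVec (su2Quat (descendTo F ℰp (J + (t + 1)) K (by omega) (fun ℓ => expPoint (ζ ℓ) * U₀ ℓ : GaugeField (F.P K) 0 (Matrix.specialUnitaryGroup (Fin 2) ℂ)) ℓ' * (descendTo F ℰp (J + (t + 1)) K (by omega) U₀ ℓ')⁻¹)) else 0)‖ ^ 2
        else 0))) :
    ∑ t ∈ Finset.range (K - J), (F.L : ℝ) ^ t * ∑ B : PBond (F.P J) 0, ‖(fun q : Plaq (F.P K) (K - (J + (t + 1))) =>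
        if ∃ z₀ : Site (F.P K) 0, (blockIter (K - J) z₀ = (bondShift (F.sitesPerDir_eq (m := F.m) (K := J) (j := 0) (m' := F.m) (K' := K) (j' := K - J) (by omega)) B).src ∨
            blockIter (K - J) z₀ = (bondShift (F.sitesPerDir_eq (m := F.m) (K := J) (j := 0) (m' := F.m) (K' := K) (j' := K - J) (by omega)) B).tgt) ∧
            ∀ κ, (rel (blockIter (K - (J + (t + 1))) z₀) q.src κ).natAbs ≤ 2 * F.L + 1
        then dist1 ((GaugeField.plaqHol (Averaging.iter (fun k => BlockAveraging.blockAvg (P := F.P K) (j := k) ℰp) (K - (J + (t + 1))) U₀) q)⁻¹ *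
          GaugeField.plaqHol (Averaging.iter (fun k => BlockAveraging.blockAvg (P := F.P K) (j := k) ℰp) (K - (J + (t + 1)))
            (fun ℓ => expPoint (ζ ℓ) * U₀ ℓ : GaugeField (F.P K) 0 (Matrix.specialUnitaryGroup (Fin 2) ℂ))) q)
        else 0)‖ ^ 2 ≤
      (2 * (((5 ^ (F.P K).d : ℕ) : ℝ) ^ 2 * (((2 * ((2 * F.L + 1) + 2) + 1) ^ (F.P K).d * 6 : ℕ) : ℝ) *
              (2 * ((((F.P K).L ^ (F.P K).d : ℕ) : ℝ) - 1) / ((((F.P K).L ^ (F.P K).d : ℕ) : ℝ) - 3))) * (4 * (F.L : ℝ)⁻¹ + W * Csrc)) * Real.exp (c * ∑ i ∈ Finset.range (K - J), (((5 * F.L : ℕ) : ℝ) ^ 2 / 4) * θ (K - i)) * (((F.L : ℝ)⁻¹) ^ (K - J) * ∑ ℓ : PBond (F.P K) 0, ‖ζ ℓ‖ ^ 2 +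
                (F.L : ℝ) ^ (K - J) * ∑ p : Plaq (F.P K) 0,
                  (1 - reTr ((GaugeField.plaqHol U₀ p)⁻¹ * GaugeField.plaqHol (fun ℓ => expPoint (ζ ℓ) * U₀ ℓ : GaugeField (F.P K) 0 (Matrix.specialUnitaryGroup (Fin 2) ℂ)) p))) +
      (2 * (((5 ^ (F.P K).d : ℕ) : ℝ) ^ 2 * (((2 * ((2 * F.L + 1) + 2) + 1) ^ (F.P K).d * 6 : ℕ) : ℝ) *
              (2 * ((((F.P K).L ^ (F.P K).d : ℕ) : ℝ) - 1) / ((((F.P K).L ^ (F.P K).d : ℕ) : ℝ) - 3))) * W * βsrc) * (∑ t ∈ Finset.range (K - J), (if ht : t < K - J then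
          (F.L : ℝ) ^ t * ∑ B : PBond (F.P J) 0,
            ‖(fun ℓ' : PBond (F.P (J + (t + 1))) 0 =>
              if ∃ z : Site (F.P (J + (t + 1))) 0,
                (B14.Eq22Determines.blockIter (t + 1) z = (bondShift (F.sitesPerDir_eq (m := F.m) (K := J) (j := 0) (m' := F.m) (K' := J + (t + 1)) (j' := t + 1) (by omega)) B).src ∨ B14.Eq22Determines.blockIter (t + 1) z = (bondShift (F.sitesPerDir_eq (m := F.m) (K := J) (j := 0) (m' := F.m) (K' := J + (t + 1)) (j' := t + 1) (by omega)) B).tgt) ∧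
                ∀ ν, (B10Eq27TorusAxialLog.rel z ℓ'.src ν).natAbs ≤ 2
              then logVec (su2Quat (descendTo F ℰp (J + (t + 1)) K (by omega) (fun ℓ => expPoint (ζ ℓ) * U₀ ℓ : GaugeField (F.P K) 0 (Matrix.specialUnitaryGroup (Fin 2) ℂ)) ℓ' * (descendTo F ℰp (J + (t + 1)) K (by omega) U₀ ℓ')⁻¹)) else 0)‖ ^ 2
        else 0)) := by
  have hL1 : (1 : ℝ) ≤ (F.L : ℝ) := by exact_mod_cast F.hL.2.le
  have hL0 : (0 : ℝ) < (F.L : ℝ) := lt_of_lt_of_le zero_lt_one hL1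
  -- the G4-i core at `θr := 2L+1`, `Cst := 1`, `Bsrc :=` the purse-shaped source letter
  have key := curlBudget_of_chartTower F hJK (2 * F.L + 1) 1 zero_le_one U₀ ζ w hw W hW X hXdef Mg hMg hMg4 α δ αp hα hα24 hαδ hα0 hδ hUs hαp0 hαp
    M hM hXM R hR0 hR (Csrc * Real.exp (c * ∑ i ∈ Finset.range (K - J), (((5 * F.L : ℕ) : ℝ) ^ 2 / 4) * θ (K - i)) * (((F.L : ℝ)⁻¹) ^ (K - J) * ∑ ℓ : PBond (F.P K) 0, ‖ζ ℓ‖ ^ 2 +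
                (F.L : ℝ) ^ (K - J) * ∑ p : Plaq (F.P K) 0,
                  (1 - reTr ((GaugeField.plaqHol U₀ p)⁻¹ * GaugeField.plaqHol (fun ℓ => expPoint (ζ ℓ) * U₀ ℓ : GaugeField (F.P K) 0 (Matrix.specialUnitaryGroup (Fin 2) ℂ)) p))) + βsrc * (∑ t ∈ Finset.range (K - J), (if ht : t < K - J then
          (F.L : ℝ) ^ t * ∑ B : PBond (F.P J) 0,
            ‖(fun ℓ' : PBond (F.P (J + (t + 1))) 0 =>
              if ∃ z : Site (F.P (J + (t + 1))) 0,
                (B14.Eq22Determines.blockIter (t + 1) z = (bondShift (F.sitesPerDir_eq (m := F.m) (K := J) (j := 0) (m' := F.m) (K' := J + (t + 1)) (j' := t + 1) (by omega)) B).src ∨ B14.Eq22Determines.blockIter (t + 1) z = (bondShift (F.sitesPerDir_eq (m := F.m) (K := J) (j := 0) (m' := F.m) (K' := J + (t + 1)) (j' := t + 1) (by omega)) B).tgt) ∧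
                ∀ ν, (B10Eq27TorusAxialLog.rel z ℓ'.src ν).natAbs ≤ 2
              then logVec (su2Quat (descendTo F ℰp (J + (t + 1)) K (by omega) (fun ℓ => expPoint (ζ ℓ) * U₀ ℓ : GaugeField (F.P K) 0 (Matrix.specialUnitaryGroup (Fin 2) ℂ)) ℓ' * (descendTo F ℰp (J + (t + 1)) K (by omega) U₀ ℓ')⁻¹)) else 0)‖ ^ 2
        else 0))) hSRC
  -- the left side: `ρP(t,B)² = 1·GG_{2L+1}(K − J − 1 − t)` after `K − (J+(t+1)) = K − J − 1 − t`
  have hLHS : ∑ t ∈ Finset.range (K - J), (F.L : ℝ) ^ t * ∑ B : PBond (F.P J) 0, ‖(fun q : Plaq (F.P K) (K - (J + (t + 1))) =>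
        if ∃ z₀ : Site (F.P K) 0, (blockIter (K - J) z₀ = (bondShift (F.sitesPerDir_eq (m := F.m) (K := J) (j := 0) (m' := F.m) (K' := K) (j' := K - J) (by omega)) B).src ∨
            blockIter (K - J) z₀ = (bondShift (F.sitesPerDir_eq (m := F.m) (K := J) (j := 0) (m' := F.m) (K' := K) (j' := K - J) (by omega)) B).tgt) ∧
            ∀ κ, (rel (blockIter (K - (J + (t + 1))) z₀) q.src κ).natAbs ≤ 2 * F.L + 1
        then dist1 ((GaugeField.plaqHol (Averaging.iter (fun k => BlockAveraging.blockAvg (P := F.P K) (j := k) ℰp) (K - (J + (t + 1))) U₀) q)⁻¹ *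
          GaugeField.plaqHol (Averaging.iter (fun k => BlockAveraging.blockAvg (P := F.P K) (j := k) ℰp) (K - (J + (t + 1)))
            (fun ℓ => expPoint (ζ ℓ) * U₀ ℓ : GaugeField (F.P K) 0 (Matrix.specialUnitaryGroup (Fin 2) ℂ))) q)
        else 0)‖ ^ 2 =
      ∑ t ∈ Finset.range (K - J), (F.L : ℝ) ^ t * ((fun t => (1 : ℝ) * ∑ B : PBond (F.P J) 0,
      ‖(fun p : Plaq (F.P K) (K - J - 1 - t) =>
        if ∃ z₀ : Site (F.P K) 0, (blockIter (K - J) z₀ = (bondShift (F.sitesPerDir_eq (m := F.m) (K := J) (j := 0) (m' := F.m) (K' := K) (j' := K - J) (by omega)) B).src ∨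
            blockIter (K - J) z₀ = (bondShift (F.sitesPerDir_eq (m := F.m) (K := J) (j := 0) (m' := F.m) (K' := K) (j' := K - J) (by omega)) B).tgt) ∧
            ∀ κ, (rel (blockIter (K - J - 1 - t) z₀) p.src κ).natAbs ≤ (2 * F.L + 1)
        then dist1 ((GaugeField.plaqHol (Averaging.iter (fun k => BlockAveraging.blockAvg (P := F.P K) (j := k) ℰp) (K - J - 1 - t) U₀) p)⁻¹ *
          GaugeField.plaqHol (Averaging.iter (fun k => BlockAveraging.blockAvg (P := F.P K) (j := k) ℰp) (K - J - 1 - t)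
            (fun ℓ => expPoint (ζ ℓ) * U₀ ℓ : GaugeField (F.P K) 0 (Matrix.specialUnitaryGroup (Fin 2) ℂ))) p)
        else 0)‖ ^ 2) t) := by
    refine Finset.sum_congr rfl fun t ht => ?_
    rw [Finset.mem_range] at ht
    have e : K - (J + (t + 1)) = K - J - 1 - t := by omega
    beta_reduce
    rw [one_mul, e]
  rw [hLHS]
  refine key.trans ?_
  rw [show (2 : ℝ) * 1 = 2 from mul_one 2]
  -- the right side: `L^{K−J}·REL ≤ purse ≤ e^{cΣθ}·purse`
  have hKL : 0 ≤ (((5 ^ (F.P K).d : ℕ) : ℝ) ^ 2 * (((2 * ((2 * F.L + 1) + 2) + 1) ^ (F.P K).d * 6 : ℕ) : ℝ) *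
              (2 * ((((F.P K).L ^ (F.P K).d : ℕ) : ℝ) - 1) / ((((F.P K).L ^ (F.P K).d : ℕ) : ℝ) - 3))) := kernelConst_nonneg F K (2 * F.L + 1)
  have hREL : 0 ≤ ∑ p : Plaq (F.P K) 0,
                  (1 - reTr ((GaugeField.plaqHol U₀ p)⁻¹ * GaugeField.plaqHol (fun ℓ => expPoint (ζ ℓ) * U₀ ℓ : GaugeField (F.P K) 0 (Matrix.specialUnitaryGroup (Fin 2) ℂ)) p)) := by
    have h := le_trans (Finset.sum_nonneg fun p _ => sq_nonneg _) (sum_dist1_relPlaq_sq_le_four_mul (P := F.P K) (fun ℓ => expPoint (ζ ℓ) * U₀ ℓ : GaugeField (F.P K) 0 (Matrix.specialUnitaryGroup (Fin 2) ℂ)) U₀ Finset.univ)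
    linarith
  have hζ : 0 ≤ ((F.L : ℝ)⁻¹) ^ (K - J) * ∑ ℓ : PBond (F.P K) 0, ‖ζ ℓ‖ ^ 2 :=
    mul_nonneg (pow_nonneg (inv_nonneg.2 hL0.le) _) (Finset.sum_nonneg fun ℓ _ => sq_nonneg _)
  have hE : (1 : ℝ) ≤ Real.exp (c * ∑ i ∈ Finset.range (K - J), (((5 * F.L : ℕ) : ℝ) ^ 2 / 4) * θ (K - i)) :=
    Real.one_le_exp (mul_nonneg hc (Finset.sum_nonneg fun i _ => mul_nonneg (by positivity) (hθ _)))
  have hX : (F.L : ℝ) ^ (K - J) * ∑ p : Plaq (F.P K) 0,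
                  (1 - reTr ((GaugeField.plaqHol U₀ p)⁻¹ * GaugeField.plaqHol (fun ℓ => expPoint (ζ ℓ) * U₀ ℓ : GaugeField (F.P K) 0 (Matrix.specialUnitaryGroup (Fin 2) ℂ)) p)) ≤ ((F.L : ℝ)⁻¹) ^ (K - J) * ∑ ℓ : PBond (F.P K) 0, ‖ζ ℓ‖ ^ 2 +
                (F.L : ℝ) ^ (K - J) * ∑ p : Plaq (F.P K) 0,
                  (1 - reTr ((GaugeField.plaqHol U₀ p)⁻¹ * GaugeField.plaqHol (fun ℓ => expPoint (ζ ℓ) * U₀ ℓ : GaugeField (F.P K) 0 (Matrix.specialUnitaryGroup (Fin 2) ℂ)) p)) := by linarith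
  exact budget_shape (mul_nonneg zero_le_two hKL) (mul_nonneg (by norm_num : (0 : ℝ) ≤ 4) (inv_nonneg.2 hL0.le))
    (mul_nonneg (pow_nonneg hL0.le _) hREL) hX hE

end Summit.QuantumFields.YangMills.Theorems.FluctuationComparisonRegPrIntLS2BetaRhoPColumnBudget

end
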